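import Summits.CriticalPhenomena.PercolationContinuityZ3.Theorems.FK.Transplant.FreeBoundaryHypotheses

/-!
# The binders of record of the conditional Kozma–Nitzan transplant, v2 (FT-01b; additive to FT-01)

**CONDITIONAL on `FH` (open at the same `p` for `q > 1`; ⇔ GRC Conj. (5.103) via K1); a typed
reduction, not a proof of FK continuity.** Builds on p205010 (kernel theorem, internal audit signed;
external expert review pending).

Barrier note cited first (FBN-01): `Literature.Barriers.CriticalPhenomena.SamePFreeBoundaryCriteria`
(theorem `samePFreeBoundaryCriteria`, named fact `Bodineau2005_slabThreshold`; landed p243859 — cited by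
name, not imported). Calibration K1, verbatim: "[C3a ∀ p > p_c(q)] ∧ C3b ⇒ p̂_c(q) = p_c(q) =
GRC Conj (5.103) = DT Question 5 (open for q ∈ (1,2))". Wording of record (R14(d)): CONDITIONAL on
FH := free-box hittability of the Kozma–Nitzan quarter-face geometry from a wired central seed under the
free random-cluster measure (KN Lemma 9 geometry with free boundary condition). `FH` is NEVER discharged,
cited or mirrored in `Literature/` by this sub-cell.

## What this file is

The BINDER VOCABULARY OF RECORD (v2) of `ufsc0_of_freeBoundaryHypothesis_r0`
(`FreeBoundaryTransplant.lean`), ADDITIVE to `FreeBoundaryHypotheses.lean` (FT-01 v1, p243857): it reuses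
BY NAME, unchanged, `fkLaw`, `hitW`, `IsHittableFK`, `FH`, `FKTargetAt`, `condFK`, `badFK`, `ValidFK`,
`OriginFK`, `UFSC0`, and adds the free look `FKLookAt`, the restricted corridor matrix `FKCorridorRestrAt`
and the five PROVE binders of record, each the VERBATIM law-swapped twin
(`prodBernoulli W ↦ fkLaw Sfin W q`, `IsHittable ↦ IsHittableFK`) of a named PUBLIC interface of the tree's
Kozma–Nitzan files, stated over FK-HITTABLE geometries (lead ruling L6, after fkt-p2's FT04-DESIGN §0.3/§1;
coordinator R16(A), referee R-ref-2):

* `KNFreeTargetHittable` (row 2, tree `TargetProperty`, KN Lemma 10) · `KNFreeElongatedHittable` (row 3,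
  tree `isHittable_of_mem_elongList_of_target`, KN Lemma 11) · `KNFreeCorridorRestr` (row 4, tree
  `CData.corridorLemma_of_target`, KN Lemma 12 in its "in the subgraph" form) · `KNFreeOriginLook` (row 5,
  tree `KSch.hQ0_of_hit`, (32) at the origin from one free look) · `KNFreeBadRestr` (row 6, tree
  `KSch.real_bad_le`, (33)/(36)–(37) per direction under the minimal law `P^x`).

Each is tagged `@[conjecture]`: an OBLIGATION node, open until a prover seat lands
`theorem … : KNFree… d q p` in its own file; the record re-cut `_r1, _r2, …` then drops the binder. At
`q = 1` each is the corresponding tree theorem with the law swapped (regression file FT-09).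

SUPERSEDED (v1, `FreeBoundaryHypotheses.lean`; superseded before any use, NOT binders of record, no
theorem consumes them): `KNFreeLaunchBound`, `KNFreeTargetProperty`, `KNFreeElongatedLaunch`,
`KNFreeCorridorBound`, `KNFreeOriginBound`, `KNFreeBadBound`, and the matrices/predicates `FKLaunchAt`,
`IsLaunchableFK`, `FKCorridorAt` (the launch Props remain the documented row-2-internal consumption form:
`IsHittableFK q p g → IsLaunchableFK q p g` for `1 ≤ q`, domain Markov = pinning, comparison of boundary
conditions = monotonicity in the weights, is the first lemma of row 2 and the referee's audit point A8).

T1⁺: every constant (`k, ℓ₀, m, R, r, δ, δ₂`) is a functional of FINITE-VOLUME laws `fkLaw Λ W q` of named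
weightings; no infinite-volume object is in the cone (A7). No statement here is claimed.

## References

* G. Kozma, S. Nitzan, arXiv:2401.12397 (2024), §4 (Lemmas 9–12, Theorem 6, pp. 16–31) [KozmaNitzan2024].
* G. Grimmett, *The Random-Cluster Model*, Springer 2006, eq. (1.20), Thm. (3.7), eq. (3.22), Conj. (5.103) [Grimmett2006].
* H. Duminil-Copin, V. Tassion, arXiv:1502.03050, Question 5.
-/

noncomputable section

open MeasureTheory
open scoped ENNReal Classical

namespace Summit.CriticalPhenomena.PercolationContinuityZ3.Theorems.FK

open Literature.Probability.Percolation Literature.Probability.LatticeModels SimpleGraph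
open Literature.Probability.Percolation.GadgetSystem Literature.Probability.Percolation.KozmaNitzan

variable {d : ℕ}

/-! ## The free look -/

/-- **The free look at thresholds** `(δ; m, ℓ)` of the geometry `g` (one instance of FK-hittability
`IsHittableFK`, whose field `hit` is literally `∀ ε > 0, ∃ k ℓ₀, ∀ m ≥ k, ∀ ℓ ≥ ℓ₀, FKLookAt q p g ε m ℓ`
by `rfl`): under the FREE random-cluster law of the hitting box `ℓQ_g` (weights `hitW`: the central seed
`Λ_m` wired, lattice edges at `p`, nothing outside the box) the seed is joined to `ℓF_g` inside `ℓQ_g` with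
probability `> 1 - δ`. Measure: `fkLaw (g.Qset ℓ 0) (hitW p g ℓ m 0) q` (b.c.: free on `ℓQ_g`, wired on `Λ_m`).
[cite: KozmaNitzan2024, §4 p. 16 (hittable geometry); Grimmett2006, Conj. (5.103)] -/
def FKLookAt (q : ℝ) (p : unitInterval) (g : Geom d) (δ : ℝ) (m ℓ : ℕ) : Prop :=
  1 - δ < (fkLaw (g.Qset ℓ 0) (hitW p g ℓ m 0) q).real (linkIn (↑(g.Qset ℓ 0)) (GM.ball 0 m) (g.Fset ℓ 0))

/-- `IsHittableFK.hit` in terms of the free look (definitional). [folklore] -/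
theorem IsHittableFK.lookAt {q : ℝ} {p : unitInterval} {g : Geom d} (h : IsHittableFK q p g)
    {ε : ℝ} (hε : 0 < ε) : ∃ k ℓ₀ : ℕ, ∀ m, k ≤ m → ∀ ℓ, ℓ₀ ≤ ℓ → FKLookAt q p g ε m ℓ :=
  h.hit ε hε

/-! ## The five PROVE binders of record (v2) -/

/-- **PROVE binder `h_tgt` (row 2) — the FK target property** (KN Lemma 10 for `fkLaw`): `∀ ε ∃ δ ∀ H` of
FK-hittable geometries `∃ R`, the target inequality `FKTargetAt` — tree `TargetProperty` VERBATIM with the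
law swapped (`prodBernoulli W ↦ fkLaw Sfin W q`, `IsHittable ↦ IsHittableFK`; its `q = 1` instance is tree
`targetProperty_of_theta_pos`). Route: launchability from hittability (`FKLaunchAt`), seed manufacture
(Lemma 10 Steps II–III with two-sided finite energy), set-target FK gluing (`FKSetTargetGluing.lean`,
p243470) in place of Conjecture 3, Step IV. CONTESTED (fkt-p2 FT04-DESIGN §3(b): the relay-selection step
KN p. 21, `P_{K_ξ}(F_P) = P_G(F_P)`, may need a wall-type look; decided by the owner's design note and the
referee, coordinator R18). Owner fkt-p1.
[cite: KozmaNitzan2024, §4 Lemma 10 (pp. 17–22); Grimmett2006, Thm. (3.7), eq. (3.4) (finite energy)] -/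
@[conjecture] def KNFreeTargetHittable (d : ℕ) (q : ℝ) (p : unitInterval) : Prop :=
  ∀ ⦃ε : ℝ⦄, 0 < ε → ∃ δ : ℝ, 0 < δ ∧ ∀ H : List (Geom d), (∀ g ∈ H, IsHittableFK q p g) →
    ∃ R : ℕ, FKTargetAt d q p δ ε H R

/-- **PROVE binder `h_elong` (row 3) — KN Lemma 11 for `fkLaw`**: the FK target property and `FH` make
every elongated geometry `[-1,1]^d → face of aspect K` (tree `elongList d K`) FK-hittable (`8K−4`
target-property applications under ONE fixed free-box weighting; no conditioning). Tree
`isHittable_of_mem_elongList_of_target` VERBATIM with the law swapped. Owner fkt-p2.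
[cite: KozmaNitzan2024, §4 Lemma 11 (p. 22)] -/
@[conjecture] def KNFreeElongatedHittable (d : ℕ) (q : ℝ) (p : unitInterval) : Prop :=
  KNFreeTargetHittable d q p → FH d q p →
    ∀ (K : ℕ) (hK : 2 ≤ K), ∀ g ∈ elongList d K (by omega), IsHittableFK q p g

/-- **The corridor inequality at thresholds `(δ, ε)` from scale `m` on, restricted form** (FK twin of
the matrix of tree `CData.corridorLemma_of_target` / `KSch.real_bad_le`'s `hcorr`, in KN's "in the
subgraph" form, p. 24): for every corridor datum `T` with `T.Hyp p` and `m ≤ T.r`: if `o ↔ c + [-3r,3r]^d`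
with probability `> 1 - δ` under the law of the weighting RESTRICTED TO `A` (`fkLaw T.Sfin (restrW A T.W) q`:
free b.c. on `A`, the pins of `T.W` inside `A` kept), then `o ↔` the far box `Tn (3r)` with probability
`> 1 - ε` under the law of the weighting restricted to the corridor region `U ⊇ A`. (At `q = 1` both sides
equal "inside `A` / inside `U` under `P_W`" — tree `FKCorridorAt`-shape; for `q ≥ 1` the consumer passes
to the unrestricted law by monotonicity in the weights, Grimmett (3.22); the events are a.s. equal to their
"inside" versions under the restricted laws.) [cite: KozmaNitzan2024, §4 Lemma 12 (pp. 23–25); Grimmett2006, eq. (3.22)] -/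
def FKCorridorRestrAt (d : ℕ) (q : ℝ) (p : unitInterval) (δ ε : ℝ) (m : ℕ) : Prop :=
  ∀ T : CData d, T.Hyp p → m ≤ T.r →
    1 - δ < (fkLaw T.Sfin (restrW (↑T.Aset : Set (Site d)) T.W) q).real
        (⋃ b ∈ Finset.Icc (T.c - ((3 * T.r : ℕ) : Site d)) (T.c + ((3 * T.r : ℕ) : Site d)), openConn T.o b) →
      1 - ε < (fkLaw T.Sfin (restrW (↑T.Uset : Set (Site d)) T.W) q).real (⋃ b ∈ T.Tn (3 * T.r), openConn T.o b)

/-- **PROVE binder `h_corr` (row 4) — KN Lemma 12 for `fkLaw`**: `∀ ε ∃ δ ∃ m`, the restricted corridor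
inequality, from the FK target property and `FH` (the `d` inward halving steps and the corridor step,
p. 24, each a target-property application under one fixed restricted weighting). Tree
`CData.corridorLemma_of_target` with the law swapped and KN's restricted form of the two events. Owner
fkt-p2. [cite: KozmaNitzan2024, §4 Lemma 12 (pp. 23–25)] -/
@[conjecture] def KNFreeCorridorRestr (d : ℕ) (q : ℝ) (p : unitInterval) : Prop :=
  KNFreeTargetHittable d q p → FH d q p →
    ∀ ⦃ε : ℝ⦄, 0 < ε → ∃ δ : ℝ, 0 < δ ∧ ∃ m : ℕ, FKCorridorRestrAt d q p δ ε m

/-- **PROVE binder `h_orig` (row 5) — (32) at the origin from one free look** (FK twin of tree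
`KSch.hQ0_of_hit`): the free look of the aspect-`6` elongated geometry of direction `du` at scale `3r`
with seed `Λ_{3r}` and threshold `S.δc` gives (32)-FK at the origin (`OriginFK`) — the origin weighting
(`Q_0` wired through `U₀ ⊇` the seed edges, lattice `p` on `E_{0,v}`, region `Q_0 ∪ E_{0,v} ⊇ 3r·Q`)
dominates `hitW` pointwise, so this is monotonicity in the weights (Grimmett (3.22)) + independence of
`fkLaw` from the ambient region + the event inclusion of the tree proof + `U₀` a.s. open. Owner fkt-p3
(fallback fkt-p2). [cite: KozmaNitzan2024, §4 p. 28 ((32) for w = 0); Grimmett2006, eq. (3.22)] -/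
@[conjecture] def KNFreeOriginLook (d : ℕ) (q : ℝ) (p : unitInterval) : Prop :=
  ∀ S : KSch d, S.p = p → ∀ du : MDir,
    FKLookAt q S.p (elongGeom (S.C.axOf du) (σu du) 6 (by norm_num)) S.δc (3 * S.C.r) (3 * S.C.r) →
      OriginFK S q du

/-- **PROVE binder `h_bad` (row 6) — (36)–(37) for one direction under the minimal law `P^x`** (FK twin
of tree `KSch.real_bad_le`, KN Steps II–IV pp. 28–31): after an FK-valid history (`ValidFK`), given the
RESTRICTED corridor inequality at `(S.δc, ε')` from scale `r` on and the target inequality at `(δ₂, S.δc)`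
for the aspect-`2K` elongated geometries with `2R ≤ s`, the bad event of direction `x` has
`P^x`-probability `≤ (1 - δ₂)^K + ε'` (`P^x = fkLaw Sx Wfull q`; the tower identities (36)–(37) are exact
under `P^x`, conditioning = pinning, Grimmett Thm. (3.7); the corridor hypothesis is met from
`ValidFK.reach` by monotonicity in the weights `W₀ ≤ restrW A Wfull`; contacts by two-sided finite energy).
Owner fkt-p4. [cite: KozmaNitzan2024, §4 pp. 28–31 ((33), (36), (37)); Grimmett2006, Thm. (3.7), eq. (3.22)] -/
@[conjecture] def KNFreeBadRestr (d : ℕ) (q : ℝ) (p : unitInterval) : Prop :=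
  ∀ S : KSch d, S.p = p → ∀ ⦃ε' δ₂ : ℝ⦄, δ₂ ≤ 1 → ∀ ⦃R : ℕ⦄,
    FKCorridorRestrAt d q S.p S.δc ε' S.C.r →
    FKTargetAt d q S.p δ₂ S.δc (elongList d (2 * S.C.K) (by have := S.C.hK; omega)) R →
    2 * R ≤ S.C.s →
    ∀ (h : ProbeHistory (Site d)) (e : Site 2 × MDir) (du : MDir), ValidFK S q h e →
      du ∈ S.onward h (tgt e) →
        (fkLaw (S.Sx h e du) (S.Wfull h e du) q).real (badFK S q h e du) ≤ (1 - δ₂) ^ S.C.K + ε'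

end Summit.CriticalPhenomena.PercolationContinuityZ3.Theorems.FK

end
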